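import Mathlib
import HarnessLib
import HarnessLib.Audit
import Summits.QuantumFields.Statement
import HarnessLib.Audit.Status.Attr

/-!
Route: FourMirrorsWardE1

# Route FourMirrorsWardE1 — four mirrors, not sixteen — no diagonal reflection positivity for Wilson
quarks, so E1 for QCD comes from the rotation Ward identity

It suffices to show X = X_neg ∧ X_pos (card four-mirrors-no-diagonal-fermion-rp). X_neg (FOUR
MIRRORS): for free r = 1 Wilson
fermions the Osterwalder–Schrader one-particle form of the DIAGONAL site reflection θ: x₀ ↔ x₁ is
positive for NO ultralocal
charge-conjugating antilinear reflection Θ_S: ψ(x) ↦ ψ̄(θx)S (S ∈ M₄(ℂ), S ≠ 0) — Hermiticity forces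
S ∈ ℝγ_n, γ_n = (γ₀−γ₁)/√2, and for
S = γ_n the reflected propagator kernel is a two-pole Hankel kernel κ₊ζ₊ʲP₊ − κ₋ζ₋ʲP₋ with both κ >
0, ζ₊/ζ₋ = (1+√2)², hence indefinite
(NoDiagonalFermionRP); the same indefiniteness reaches the flavour-changing pseudoscalar channel
that carries the `pseudoRe` species of
`QCDOf` (PseudoscalarDiagonalRPFails). So lattice QCD has the four axis mirror families only, and
the YangMills-sub "sixteen mirrors ⇒
B₄-rigidity ⇒ O(4)" transfer (cards sixteen-mirrors-o4-rigidity, hidden-diagonal-rp-wilson-quarks)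
cannot supply axiom E1 for the QCD
conjunct. X_pos (WARD E1): E1 is produced in the limit instead — every gapped, asymptotically
scaling sequential limit of the lattice QCD
Schwinger functions is SO(4)-invariant on ⁰𝒮 (RotationRestoration; intended engine: the rotation
Ward identity of the
Caracciolo–Curci–Menotti–Pelissetto lattice stress tensor with k-uniform a²-insertion bounds), and
with the rotation half of E1 removed the
conjunct is what any existence route must deliver (QCDModuloRotations).
Lean: `NoDiagonalFermionRP ∧ PseudoscalarDiagonalRPFails ∧ RotationRestoration` (decls of this
route; all elaborate in Sketch.lean / SketchFlat.lean, rc 0; deciding theorem `closes :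
RotationRestoration → QCDModuloRotations → QCD` by pure logic, re-elaborated against the re-typed
`QCDOf` 2026-08-16)

## Assembly
Pure logic, checked sorry-free in Sketch.lean (`assembly_holds`): for N_f ∈ {2,3} QCDModuloRotations
gives reg with its mass-scaling and chiral-at-zero clauses
(`reg.HasMassScaling`, `reg.IsChiralAtZero` — the latter since the statement re-type p117723), and
for each mass tuple
z, shift and the rotation-free package S; RotationRestoration applied to sch = reg.scheme m z shift
(its asymptotic scaling, physical
branch and lattice gap come with the package) gives the rotation half of E1 for S; the conditional
clause then yields T : OSData with
T.schwinger = S, whence `IsQCDAlong (reg.scheme m z shift) T` (convergence transferred along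
T.schwinger = S), the non-triviality clauses,
`T.HasMassGap Δ` (= S.HasMassGap Δ) and the lattice gap: `QCDOf 2 ∧ QCDOf 3 = QCD`. The negative
cruxes are not hypotheses of the
assembly: they are the route's negative side (D-0014), deciding which E1 engine the QCD conjunct may
use and becoming negatives-index
entries for the summit once proved.

Rationale: WHY THIS LINE. Two live cards of this summit bet opposite ways on the same finite object:
sixteen-mirrors-o4-rigidity (YangMills) and
hidden-diagonal-rp-wilson-quarks (QCD, det-Schwarz numerics) want reflection positivity across the
twelve diagonal hyperplanes to turn the
hypercubic lattice's W(B₄) into O(4), while this card says Lüscher's projector miracle (Luscher1977;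
MontvayMunster1994 (4.99)–(4.111);
MenottiPelissetto1987, axis planes only) is axis-aligned and the diagonal dispersion of r = 1 Wilson
fermions has TWO poles
(denominator quadratic in cos p_n), which a single spin matrix cannot make positive. The planner's
own analysis (zero parallel momentum:
symbol Σ_ε P_ε/(μ − 2cos r + i√2ε sin r), Fourier coefficients κ_ε ζ_εʲ with ζ_ε =
(μ−√(μ²−2))/(2−ε√2), universal ratio ζ₊/ζ₋ = 3+2√2;
Hermiticity ⇒ S ∈ ℝγ_n) and kit jobs j000711 (d = 4 open boxes 3⁴,4⁴,5⁴, m = 0.3, 1, 3: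
Hermitian-admissible subspace of M₄(ℂ) is exactly
ℝγ_n; K_{γ_n} indefinite, e.g. eigenvalues [−0.100, +0.009] at 5⁴, m = 1; axis site-reflection
control definite; pseudoscalar channel
indefinite from 4⁴ on) and j000712 (d = 2 reproduction of the card's numbers to three digits)
confirm the negative half; the scalar engine
is already PROVED in the tree (Literature.Barriers.QuantumFields.not_isRPKernel_twoExpKernel) and
the fermionic necessity philosophy is
JaffeJanssens2016 Thm 29 (RP for all small couplings forces positivity of the cross-plane coupling
matrix). The positive half is the
textbook restoration mechanism (CaraccioloEtAl1988, CaraccioloEtAl1990, Symanzik1983,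
DavoudiSavage2012, LangRebbi1982) stated as an
engine-agnostic E1 module, with the only non-perturbative rotation-restoration theorem for a lattice
model (DKKMO2020Rotational, planar FK)
and the YM card coincidence-lattice-rotation-bootstrap as alternative engines that also use axis RP
only. Imported areas: reflection
positivity / Källén–Lehmann moment structure (constructive QFT, operator algebras), lattice Ward
identities (lattice field theory);
nothing in the negatives index (empty) is touched.

RANKED CRUXES. #2 NoDiagonalFermionRP (crux) — For every bare mass m > 0 and every nonzero spin
matrix S ∈ M₄(ℂ) there is a θ-symmetric open box {0,…,n−1}⁴ (n = 2R+3, free b.c., realised as the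
wrap-free principal submatrix of the tree's torus `wilsonDirac` at U = 1, N = 1, r = 1, side n+1) on
which the one-particle OS kernel of the diagonal site reflection θ = (x₀ ↔ x₁) with Θ_S ψ_α(x) = Σ_β
ψ̄_β(θx) S_{βα}, K((x,α),(y,α')) = −Σ_β D⁻¹((y,α'),(θx,β)) S_{βα} on Λ₊ = {x₁ < x₀}, is NOT positive
semidefinite (not Hermitian, or a negative direction). Card item K1, typed for d = 4 as the novelty
audit asked. [difficulty: M] (why it might fail: Only ultralocal translation-invariant
charge-conjugating Θ_S are covered; a Θ twisted by a local automorphism (JaffeJanssens2016 §6: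
site-dependent S(x), ψ↔ψ̄ mixing, doubler-adapted) is outside, and a proof for ALL m>0 needs the
two-pole analysis, not one certificate.) [MontvayMunster1994, Luscher1977, MenottiPelissetto1987,
OsterwalderSeiler1978, JaffeJanssens2016, FrohlichIsraelLiebSimon1978,
Literature.Barriers.QuantumFields.RegularisationDichotomy, kit:j000711, kit:j000712]
#3 RotationRestoration (crux) — E1 MODULE FOR QCD. For every N_f, every sequential lattice-QCD
scheme sch with two-loop asymptotic scaling, bare Wilson masses eventually on the physical branch
m_f(k) > −1, and a uniform lattice mass gap, every labelled Schwinger family S on (ℝ⁴)ⁿ that is the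
k → ∞ limit of the honest lattice QCD n-point functions `qcdLatticeSchwinger sch k` on off-diagonal
tensor test functions is invariant under proper rotations on ⁰𝒮 (the rotation half of
`IsEuclideanInvariant`). Intended engine (card K2): conserved lattice angular-momentum current from
the CCMP lattice energy–momentum tensor, whose hypercubic-to-O(4) defect is a_k² × (dimension-6
gluonic and fermionic operators), plus k-uniform insertion bounds from the UV construction;
alternative engines: Σ5 commensurate self-comparison (card coincidence-lattice-rotation-bootstrap),
never diagonal mirrors. [difficulty: open-problem] (why it might fail: A universality claim for ALL
sequential limits, incl. schemes on the Wilson critical line inside Aoki-phase fingers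
(SharpeSingleton1998) where no Symanzik expansion exists; the a²-suppression of O₆ insertions needs
non-perturbative control of logs = a UV-construction output.) [CaraccioloEtAl1990,
CaraccioloEtAl1988, Symanzik1983, DavoudiSavage2012, LangRebbi1982, DKKMO2020Rotational,
SharpeSingleton1998, Literature.Barriers.QuantumFields.RegularisationDichotomy,
Literature.Barriers.QuantumFields.UVStabilityNonUniqueness]
#4 PseudoscalarDiagonalRPFails (crux) — SPECIES LEVEL. For every m > 0 there is a θ-symmetric open
box (as in NoDiagonalFermionRP) on which the reflected flavour-changing pseudoscalar two-point
kernel across the diagonal mirror at the free point, G(x,y) = tr[γ₅ C(θx,y) γ₅ C(y,θx)] on Λ₊ (the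
Θ-image of ψ̄_f iγ₅ ψ_g by the order-reversing bilinear rule of MontvayMunster1994 (4.92) with γ₄ ↦
γ_n; −⟨Θ(F)F⟩ up to a positive colour factor), is INDEFINITE: some v gives a negative, some w a
positive value of the Hermitian form. This is the sector of the species `QCDField.pseudoRe f g`;
indefiniteness there blocks inheritance of diagonal RP for the quark-bilinear species at the
weak-coupling end (β → ∞ on a fixed box, by continuity of finite-box expectations of gauge-invariant
F). [deps: NoDiagonalFermionRP] [difficulty: M] (why it might fail: At zero parallel momentum the
channel is single-rate ((ζ₊ζ₋)ʲ: tr[P₊γ₅P₊γ₅] = 0) hence of one sign; indefiniteness comes from P ≠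
0 sectors and appears only from 4⁴ on (3⁴ is semidefinite, j000711): a large-box/continuum artefact
check is needed.) [MontvayMunster1994, OsterwalderSeiler1978, kit:j000711, JaffeJanssens2016]
#5 QCDModuloRotations (crux) — THE REST OF THE CONJUNCT. For N_f = 2 and N_f = 3: one
mass-independent regularisation reg with leading-log mass scaling, chiral at zero
(`reg.IsChiralAtZero`: the uniform lattice gap fails at arbitrarily small positive masses —
statement re-type p117723; imports Goldstone gaplessness of massless N_f ≥ 2 QCD,
GasserLeutwyler1984, SharpeSingleton1998 for the fixed-a caveat), such that for every tuple of
positive renormalised masses there are species renormalisations z, shift and a labelled Schwinger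
family S with E0 (normalisation, hermiticity), E0', TRANSLATION invariance, E2, E3, E4, which is the
sequential continuum limit of honest lattice QCD along reg.scheme m z shift (asymptotic scaling,
physical branch, convergence on off-diagonal tensors), has a mass gap Δ > 0 of all species strings
together with the uniform lattice gap at the same couplings, and which — once the rotation half of
E1 holds for S — packages into OS data T (T.schwinger = S) with non-trivial, non-Gaussian glue and
every flavour-changing pseudoscalar non-trivial. Exactly `QCDOf 2 ∧ QCDOf 3` with rotations excised;
shared with every existence route. [deps: RotationRestoration] [difficulty: open-problem] (why it
might fail: It is the existence-and-gap problem minus rotations: no UV-stable construction of 4D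
non-abelian gauge theory WITH dynamical fermions exists (Bałaban: pure YM; block fermions only in
small fields), and the uniform lattice gap through the crossover has no engine.) [JaffeWitten2000,
OsterwalderSeiler1978, Seiler1982, MontvayMunster1994, Balaban1989LargeFieldII,
BalabanOcarrollSchor1989, MagnenRivasseauSeneor1993,
Literature.Barriers.QuantumFields.UVStabilityNonUniqueness]
#9 MatrixTwoExpKernel (support) — ENGINE OF THE TWO-POLE MECHANISM (matrix Källén–Lehmann atoms).
For Hermitian A, B ∈ M_d(ℂ) and 0 < ζ₁ ≠ ζ₂ the block Hankel kernel (k,k') ↦ ζ₁^{k+k'}A + ζ₂^{k+k'}B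
on k, k' ≥ 1 is of positive type iff A ≥ 0 and B ≥ 0 (Gram identity; witness k = (1,2), c = (ζ₂v,
−v) kills the B-square). Scalar case proved in tree:
Literature.Barriers.QuantumFields.not_isRPKernel_twoExpKernel / isRPKernel_twoExpKernel_of_nonneg.
[difficulty: provable-now] [Literature.Barriers.QuantumFields.RegularisationDichotomy,
GlimmJaffe1987]
#9 NoDiagonalFermionRPUnitMass (support) — THE CHEAPEST CERTIFIED INSTANCE of NoDiagonalFermionRP: m
= 1, box 3⁴ (R = 0), all S ≠ 0. Everything is exact linear algebra over ℚ(i) (D is 324 × 324; the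
Hermiticity constraints on the 32 real parameters of S have a one-dimensional solution space ℝγ_n —
j000711: smallest singular values 3·10⁻⁹, 0.034, 0.042 —, and K_{γ_n} has eigenvalues of both signs,
[−0.049, +0.0037]); a prover may certify ~10 entries of D⁻¹ by sparse solves D h = e and two
rational test vectors. [difficulty: provable-now] [kit:j000711, MontvayMunster1994]

TWO-LAYER PLAN. Foreseen glued splits (none filed now; k ≤ 3, depth 1):
NoDiagonalFermionRP ⇐ HermitianForcesGammaN (on every θ-symmetric box n ≥ 3 the Hermiticity
constraints S*γ_nC(w)γ_n = C(w)S have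
solution space ℝγ_n, from the linear independence of the 1, γ_n, γ_t, γ₂, γ₃ components of the free
propagator) → TwoPoleIndefinite (for
S = γ_n: a two-distance, mirror-staggered test function makes the form negative and another positive
— MatrixTwoExpKernel with the
zero- /π-parallel-momentum residues, or infinite-volume Fourier analysis + box approximation for m >
0) → NoDiagonalFermionRP.
RotationRestoration ⇐ LatticeRotationWI (conserved hypercubic stress tensor, divergence of the
would-be angular-momentum current =
a² Σ c_i O₆⁽ⁱ⁾ exactly on the lattice, CaraccioloEtAl1990) → UniformInsertionBound (k-uniform bounds
C a_k^{2−η} on smeared O₆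
insertions at fixed physical separations along the scheme) → RotationRestoration (plus density of
off-diagonal tensors in ⁰𝒮).
PseudoscalarDiagonalRPFails ⇐ (same two children as NoDiagonalFermionRP with the loop kernel: three
rates ζ₊², ζ₊ζ₋, ζ₋² at P ≠ 0).
A later, separate NEGATIVE item if wanted by tenure: InteractingPseudoscalarRPFails (β large, fixed
box: failure of diagonal RP of the
honest lattice QCD measure in the pseudoscalar sector, by β → ∞ continuity from
PseudoscalarDiagonalRPFails).

KILL CRITERIA. ¬NoDiagonalFermionRP (an S ≠ 0 making the diagonal one-particle kernel PSD on all
large boxes for some m > 0) refutes the card's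
mechanism and the negative half: close `refuted:NoDiagonalFermionRP` and route the card
hidden-diagonal-rp-wilson-quarks instead (its
HDRP then has a free-field anchor). ¬PseudoscalarDiagonalRPFails alone ⇒ drop it (the one-particle
negative stands; the species-level
claim is withdrawn and the sixteen-mirror transfer for `pseudoRe` species is re-opened as a
question). ¬RotationRestoration (a gapped
AF-scaling sequential limit that is not SO(4)-invariant) kills the positive half AND the E1 clause
of every lattice route of both
conjuncts — pivot to a scheme-restricted E1 (specific β_k, m(k) away from the Aoki fingers).
QCDModuloRotations is shared: its
refutation is ¬QCD in all but name. The route is mooted (superseded) if a QCD existence route lands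
E1 by another engine.

NOT DECOMPOSED YET. The Θ-generality beyond ultralocal constant S (JaffeJanssens2016 §6 twisted
reflections Θ' = α⁻¹Θα by local automorphisms; flavour
permutations and colour mixing reduce to the N = 1 case at U = 1 by block structure — a remark, not
an item); the measure-level question
(b) "is e^{−βS_W} ∏ det D_W dU reflection positive across diagonal mirrors for bosonic link
observables?" — contested by the det-Schwarz
numerics of hidden-diagonal-rp-wilson-quarks (kit j000464/j000543, no violation found) and NOT
claimed here either way (large-β
perturbation is inconclusive because the pure-gauge quadratic form is RP-good, sixteen-mirrors P1);
the interacting-measure corollary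
at large β; the lattice stress-tensor vocabulary (definition work, see Definition requests); the
density lemma for off-diagonal tensors
in ⁰𝒮; constants of the insertion bounds. All are layer-2 children or tenure decisions after
NoDiagonalFermionRP closes.

CHEAPEST FALSIFIER. Already run by the planner (kit j000711, d = 4, numpy, exact inversion of the
open-box Wilson–Dirac operator; j000712, d = 2): search
the FULL 32-real-parameter space M₄(ℂ) for spin matrices S making the diagonal one-particle kernel
Hermitian — result: a one-dimensional
solution space ℝγ_n on 3⁴, 4⁴, 5⁴ at m = 0.3, 1, 3 (gap to the next singular value ≥ 10⁶), and
K_{γ_n} indefinite in all nine cases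
(negative-to-positive eigenvalue ratio ≈ 11:1), axis control definite to 10⁻¹⁶. What would still
kill the line cheaply: (i) the same
scan with SITE-DEPENDENT S(x) (32·|Λ₊| parameters, one SVD) finding a Hermitian-and-PSD solution;
(ii) for the positive half nothing is
cheap — but a W(B₄)-invariant, RP, clustering, NON-isotropic Schwinger family arising as an
AF-scaling limit of any lattice gauge model
would falsify RotationRestoration's universality reading.

NUMBERS. Zero-parallel-momentum diagonal rates (μ = m + 2): ζ_ε = (μ − √(μ²−2))/(2 − ε√2); ζ₊ =
0.830, 0.605, 0.349 and ζ₋ = 0.142, 0.104, 0.060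
at m = 0.3, 1, 3; ζ₊/ζ₋ = (1+√2)² = 5.828 for every m (the P₋ component is a cutoff-scale 'diagonal
doubler': ζ₋ → 3 − 2√2 as m → 0
while ζ₊ → 1). Leading hopping order of the reduced kernel at distance (1,1) in the sector B² =
cos²(P/2) = b: eigenvalues
−√2 b ± √(1/4 + 2b²) — one of each sign for every b ∈ [0,1] (largest positive part at P = π: ±1/2,
i.e. mirror-staggered test
functions). Kit j000711 (S = γ_n, [min, max] eigenvalue of K): 3⁴: [−0.095, +0.0070] (m=0.3),
[−0.049, +0.0037] (m=1), [−0.0126,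
+0.0010] (m=3); 4⁴: [−0.165, +0.0128], [−0.077, +0.0067], [−0.0172, +0.0018]; 5⁴: [−0.236, +0.0174],
[−0.100, +0.0090]; pseudoscalar
channel 5⁴: [−2.2·10⁻⁴, +2.7·10⁻³] (m=0.3), [−6.4·10⁻⁵, +8.5·10⁻⁴] (m=1); axis controls: max
eigenvalue ≤ 1.2·10⁻¹⁶ (one-particle),
min ≥ +1.4·10⁻⁹ (pseudoscalar). Kit j000712 reproduces the card's d = 2 table: 7²: [−0.652,
+0.0285], [−0.182, +0.0139], [−0.0267,
+0.0032]; 9², m = 0.3: [−0.782, +0.0300]. Items at open: 7 (4 cruxes, 2 support, 1 assembly).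

DEFINITION REQUESTS. None filed at open. Foreseen for the layer-2 children of RotationRestoration
(tenure): `latticeStressTensor` / `rotationWardDefect`
(the CaraccioloEtAl1990 hypercubic energy–momentum tensor of Wilson's gauge + fermion action and the
exact lattice identity expressing
the divergence of x_μT_{νρ} − x_νT_{μρ} as a² × dimension-6 operators), topic
Literature/MathematicalPhysics/QuantumFieldTheory.
Acquisition filed: acq-02619 (MenottiPelissetto1987, paywalled; wanted for the exact scope of their
positivity proof — which reflections, which r). CONE FACTS (route-repair gen 1, 2026-08-15): the
dispatcher's import-cone guardrail counts 5 unproved named facts under this route. None is a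
hypothesis of any item or of `closes`: the gate's `#h21_route_deps` on the rendered file (repair
session 2026-08-15) gives 119 project constants and 0 unproved Literature facts — the only closed
Props without a `_holds` witness are this route's 7 items and the target `QCD` (`QCDOf`,
`IsQCDAlong`, `OSData.HasMassGap` enter as binder-carrying statement predicates, exempt) — and the
ledger reports the route staffable (0 unproved deps). The route has no imports of its own (the four
header imports are the gate's; 0 droppable), so nothing is restated. All five sit in the mandatory
import chain of Summits/QuantumFields/QCD/Statement.lean itself (QCDOS → GrassmannIntegral ∣
YangMillsOS → YangMillsEuclidean ∣ ContinuumLimitLGT → GaugeGroups, LatticeGaugeDLR →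
ConstructiveQFTWave0) and are shared by every QCD route. needs-fact:
Literature.MathematicalPhysics.QuantumLattice.not_isSimpleCompactGroup_unitaryGroup
(GaugeGroups.lean:266; provable-now, size S — U(n), n non-empty, is not a simple compact group; two
checked sorry-free candidate discharges `not_isSimpleCompactGroup_unitaryGroup_holds` are attached
as evidence to stmt-QuantumFields-9774, so a literature-prover only has to land one, e.g. as
Literature/MathematicalPhysics/QuantumLattice/GaugeGroupsUnitaryProofs.lean; flagged so the one
dischargeable blocker gets a tier-0 seat, deliberately NOT added as an item here, which would pull
an unproved closed fact into this route's clean constant cone). NOT debt (CONVENTIONS §4: `[status: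
open]` open problems are never dischargeable facts — census/tag hygiene for the operator, no
literature-prover seats): Literature.MathematicalPhysics.QuantumFieldTheory.ClayYangMillsEuclidean,
ClayYangMillsEuclideanGap, ClayYangMillsEuclideanAlong (YangMillsEuclidean.lean:207/248/297) and
CaoParkSheffieldProblem (ConstructiveQFTWave0.lean:322). Settled, not debt:
Literature.MathematicalPhysics.QuantumLattice.isSpecification_ymSpecification
(LatticeGaugeDLR.lean:392) is refuted as stated (`not_isSpecification_ymSpecification_indiscrete`)
and its corrected twin `isSpecification_ymSpecification_t2` is proved
(`isSpecification_ymSpecification_t2_holds`); `isSimpleCompactGroup_specialUnitaryGroup_holds` is in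
tree.

Novelty: Searches (2026-08-15): `lit search --source crossref "Characterization of reflection positivity
Majoranas and spins"` (8 rows: JaffeJanssens2016 doi:10.1007/s00220-015-2545-z, JaffePedrocchi2015,
Hayajneh 'Twisted reflection positivity' thesis) + `lit read arxiv:1506.04197` pp. 11, 15 (Thm 29
necessary-and-sufficient cross-plane criterion; §6 twisted reflections); `lit search --source
crossref "Menotti Pelissetto general proof Osterwalder-Schrader positivity Wilson action"`
(doi:10.1007/bf01221251, paywalled → acq-02619); `lit search --source crossref "Caracciolo Curci
Menotti Pelissetto energy-momentum tensor lattice restoration Poincaré"` (8 rows: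
doi:10.1016/0003-4916(90)90203-z, doi:10.1016/0550-3213(88)90332-x,
doi:10.1016/0550-3213(92)90339-d); `lit read book:montvay1994-quantum-fields-lattice --grep
"reflection positiv"` (pp. 180–185: (4.91)–(4.92) link reflection and bilinear rule, (4.99) site
reflection, p. 184 "site-reflection positivity is valid only for r=1 and |K|<1/6 … link-reflection …
for every |r| ≤ 1" — coordinate planes only); `lit frontier QuantumFields --since 2020` (30 rows;
arXiv:2606.19362 'Reflection-positive construction of 4D SU(N) YM' noted, nothing on diagonal
mirrors or fermionic RP characterisations); `lit bridges QuantumFields --cross any`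
(DKKMO2020Rotational via CriticalPhenomena roots: the one non-perturbative rotation-restoration
theorem); hub cards read in full: hidden-diagonal-rp-wilson-quarks (opposite bet, det-Schwarz
numerics), sixteen  [refs: 10.1007/s00220-015-2545-z, 10.1007/bf01221251, 10.1016/0003-4916(90, 10.1016/0550-3213(88, 10.1016/0550-3213(92, 1506.04197, 2606.19362, doi:10.1007/s00220-015-2545-z, arxiv:1506.04197, doi:10.1007/bf01221251, doi:10.1016/0003-4916, doi:10.1016/0550-3213, book:montvay1994-quantum-fields-lattice, JaffeJanssens2016, JaffePedrocchi2015, Luscher1977, OsterwalderSeiler1978, MenottiPelissetto1987, Montv]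

Barriers (technique_class: reflection-positivity, rotation-ward-identity, neg-route): - technique_class: reflection-positivity, rotation-ward-identity, neg-route
- Literature.Barriers.QuantumFields.RegularisationDichotomy: this route is the barrier SHARPENED for
QCD — the lattice keeps (axis) reflection positivity and loses rotations, and for Wilson quarks not
even the discrete diagonal mirrors are positivity-compatible (NoDiagonalFermionRP is a fermionic
sibling of the barrier's proved `not_isRPKernel_twoExpKernel`); the positive half takes the
barrier's evasion (b) "recover the missing axiom dynamically in the limit" via the rotation Ward
identity, with no second (non-RP) regularisation and no uniqueness-across-cutoffs device, so
InfraredRenormalons is not met.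
- Literature.Barriers.QuantumFields.ImprovedActionPositivityViolation: same phenomenon class
(positivity is fragile under changes of lattice structure); we change nothing in the action —
Wilson's r = 1 action keeps its axis transfer matrix; only the diagonal reading is shown
unavailable.
- Literature.Barriers.QuantumFields.UVStabilityNonUniqueness: conceded for RotationRestoration and
QCDModuloRotations — E1 by Ward identity needs genuine k-uniform control of dimension-6 insertions
(a UV-construction output), not compactness; the route names this as the crux instead of hiding it;
the negative cruxes are untouched by it (finite-dimensional).
- Literature.Barriers.QuantumFields.NielsenNinomiya: the culprit is exactly the Wilson term's
axis-aligned doubler removal (the P₋ 'diagonal doubler' with rate rat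

History (route lifecycle, newest last):
- 2026-08-16T23:11:31Z · rev 5: restated QCDModuloRotations (stmt-QuantumFields-8842) — route-repair(statement-revised p117723): QCDOf gained `reg.IsChiralAtZero`. This route's scheme-level content lives in the crux QCDModuloRotations (= the conjun (planner-rrepair-QuantumFields-FourMirrorsWardE-7baae72d-0)
- 2026-08-17T15:07:15Z · rev 11: restated Assembly (stmt-QuantumFields-8845) — crux-strategist r1: Assembly restated to the type of the current closes (rev 9 redirect of QCDModuloRotations onto HonestLatticeLimit + GappedLimitClosure) (planner-cstrat-stmt-QuantumFields-17271-r1-0)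
- 2026-08-24T17:50:33Z · DORMANT — reconciler: no traction for 6.9 d (last activity item-evidence-added at 2026-08-17T18:31:48Z); parked, not closed — `ledger route dormant route-QuantumFields-Fo (operator:999:390179)
- 2026-08-28T19:24:00Z · REACTIVATED — reconciler: reactivated — activity statement-closed at 2026-08-28T17:03:51Z after parking at 2026-08-24T17:50:33Z (operator:999:2565852)

sub-problem: QCD · status: open · opened planner-plancard-QuantumFields-QCD-four-mirro-9511fd1a-0 2026-08-15T13:35:15Z · rev 11 · ledger route-QuantumFields-FourMirrorsWardE1
GENERATED by the gate from the ledger (D-0016/17). Provers cite these decls: `theorem foo : Summit.QuantumFields.QCD.Theses.FourMirrorsWardE1.<Decl> := …` in Summits/QuantumFields/QCD/Theorems/<Name>.lean.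
-/

namespace Summit.QuantumFields.QCD.Theses.FourMirrorsWardE1

open scoped BigOperators Topology Manifold Classical MeasureTheory ProbabilityTheory Matrix InnerProductSpace ComplexConjugate ContinuousMap
open Filter Set Function TopologicalSpace MeasureTheory

attribute [summit_statement] _root_.QCD

/-- item stmt-QuantumFields-8839 · crux · rank 2 · open · by planner
why it might fail: ∀m∀S rests on two unproved reductions (P=0 sketch + numerics, m∈{0.3,1,3}, boxes 3⁴–5⁴, j000711/712): K Hermitian ⇒ S∈ℝγ_n; for S=±γ_n one sign fails PSD only via the small eigenvalues of K_{γ_n} (+.0037/.0067/.0090, m=1): the 2nd pole's residue must be ≠0 at all m; MM p.184: RP proofs not necessary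
sources: MontvayMunster1994, Luscher1977, MenottiPelissetto1987, OsterwalderSeiler1978, JaffeJanssens2016, FrohlichIsraelLiebSimon1978
[crux] For every bare mass m > 0 and every nonzero spin matrix S ∈ M₄(ℂ) there is a θ-symmetric open
box {0,…,n−1}⁴ (n = 2R+3, free b.c., realised as the wrap-free principal submatrix of the tree's
torus `wilsonDirac` at U = 1, N = 1, r = 1, side n+1) on which the one-particle OS kernel of the
diagonal site reflection θ = (x₀ ↔ x₁) with Θ_S ψ_α(x) = Σ_β ψ̄_β(θx) S_{βα}, K((x,α),(y,α')) = −Σ_β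
D⁻¹((y,α'),(θx,β)) S_{βα} on Λ₊ = {x₁ < x₀}, is NOT positive semidefinite (not Hermitian, or a
negative direction). Card item K1, typed for d = 4 as the novelty audit asked. [difficulty: M] -/
@[route_item "route-QuantumFields-FourMirrorsWardE1"]
def NoDiagonalFermionRP : Prop :=
  ∀ (m : ℝ), 0 < m → ∀ (S : Matrix (Fin 4) (Fin 4) ℂ), S ≠ 0 → ∃ R : ℕ, let n : ℕ := 2 * R + 3; let ι : (Fin 4 → Fin n) → Literature.Probability.LatticeModels.TorusSite 4 (n + 1) := fun x i => ((x i : ℕ) : ZMod (n + 1)); let D : Matrix ((Fin 4 → Fin n) × Fin 4) ((Fin 4 → Fin n) × Fin 4) ℂ := (Literature.MathematicalPhysics.QuantumLattice.wilsonDirac (L := n + 1) (1 : Unit →* Matrix (Fin 1) (Fin 1) ℂ) (fun _ => ()) m 1).submatrix (fun p => (ι p.1, (0 : Fin 1), p.2)) (fun p => (ι p.1, (0 : Fin 1), p.2)); let θ : (Fin 4 → Fin n) → (Fin 4 → Fin n) := fun x => x ∘ Equiv.swap (0 : Fin 4) 1; let K : Matrix ({x : Fin 4 → Fin n // x 1 <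 x 0} × Fin 4) ({x : Fin 4 → Fin n // x 1 < x 0} × Fin 4) ℂ := Matrix.of fun p q => -∑ β : Fin 4, D⁻¹ (q.1.1, q.2) (θ p.1.1, β) * S β p.2; ¬ (K.IsHermitian ∧ ∀ v : {x : Fin 4 → Fin n // x 1 < x 0} × Fin 4 → ℂ, 0 ≤ (star v ⬝ᵥ K.mulVec v).re)

/-- item stmt-QuantumFields-8840 · crux · rank 3 · open · by planner
why it might fail: Stated for ALL N_f (N_f≥17: b₀<0, HasAsymptoticScaling forces β_k→−∞, junk regime), all z_s(k), every sequential limit incl. schemes near Aoki fingers, no Symanzik expansion (SharpeSingleton1998); the k-uniform a²·O₆ insertion bound is an unbuilt UV output (NP precedent: planar-critical only, DKKMO)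
sources: CaraccioloEtAl1990, CaraccioloEtAl1988, Symanzik1983, LangRebbi1982, DavoudiSavage2012, DKKMO2020Rotational
[crux] E1 MODULE FOR QCD. For every N_f, every sequential lattice-QCD scheme sch with two-loop
asymptotic scaling, bare Wilson masses eventually on the physical branch m_f(k) > −1, and a uniform
lattice mass gap, every labelled Schwinger family S on (ℝ⁴)ⁿ that is the k → ∞ limit of the honest
lattice QCD n-point functions `qcdLatticeSchwinger sch k` on off-diagonal tensor test functions is
invariant under proper rotations on ⁰𝒮 (the rotation half of `IsEuclideanInvariant`). Intended
engine (card K2): conserved lattice angular-momentum current from the CCMP lattice energy–momentum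
tensor, whose hypercubic-to-O(4) defect is a_k² × (dimension-6 gluonic and fermionic operators),
plus k-uniform insertion bounds from the UV construction; alternative engines: Σ5 commensurate
self-comparison (card coincidence-lattice-rotation-bootstrap), never diagonal mirrors. [difficulty:
open-problem] -/
@[route_item "route-QuantumFields-FourMirrorsWardE1", crux]
def RotationRestoration : Prop :=
  ∀ (Nf : ℕ) (sch : Literature.MathematicalPhysics.QuantumFieldTheory.QCDScheme Nf), sch.HasAsymptoticScaling → (∀ fl : Fin Nf, ∀ᶠ k in Filter.atTop, -1 < sch.mq fl k) → (∃ Δ : ℝ, 0 < Δ ∧ sch.HasLatticeMassGap Δ) → ∀ S : Literature.MathematicalPhysics.AQFT.LabelledSchwingerFamily (Literature.MathematicalPhysics.QuantumFieldTheory.QCDField Nf) (EuclideanSpace ℝ (Fin 4)), (∀ n : ℕ, n ≠ 0 → ∀ (σ : Fin n → Literature.MathematicalPhysics.QuantumFieldTheory.QCDField Nf) (f : Fin n → SchwartzMap (EuclideanSpace ℝ (Fin 4)) ℝ) (F : SchwartzMap (Fin n → EuclideanSpace ℝ (Fin 4)) ℂ), Literature.MathematicalPhysics.QuantumLattice.IsTensorOf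 F (fun i => Literature.MathematicalPhysics.QuantumLattice.ofRealTest (f i)) → Literature.MathematicalPhysics.AQFT.IsOffDiagonal F → Filter.Tendsto (fun k : ℕ => Literature.MathematicalPhysics.QuantumFieldTheory.qcdLatticeSchwinger sch k n σ f) Filter.atTop (nhds (S n σ F))) → ∀ (n : ℕ) (σ : Fin n → Literature.MathematicalPhysics.QuantumFieldTheory.QCDField Nf) (Rot : EuclideanSpace ℝ (Fin 4) ≃ₗᵢ[ℝ] EuclideanSpace ℝ (Fin 4)), LinearMap.det (Rot.toLinearEquiv : EuclideanSpace ℝ (Fin 4) →ₗ[ℝ] EuclideanSpace ℝ (Fin 4)) = 1 → ∀ F : SchwartzMap (Fin n → EuclideanSpace ℝ (Fin 4)) ℂ, Literature.MathematicalPhysics.AQFT.IsOffDiagonal F → S n σ (Literature.MathematicalPhysics.QuantumLattice.linActMulti Rot F) = S n σ F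

/-- item stmt-QuantumFields-8841 · crux · rank 4 · open · by planner
why it might fail: G(x,y)=‖C(θx,y)‖²_HS is entrywise ≥0 (γ₅-hermiticity; Weingarten1983), its P=0 sector single-rate hence PSD: indefiniteness needs subleading P≠0 structure — tiny ([−6.4e−5,+8.5e−4] on 5⁴, m=1), absent on 3⁴, none reported for m≥3 (hopping regime); only odd n=2R+3 admissible: 5⁴ the sole witness yet.
sources: MontvayMunster1994, OsterwalderSeiler1978, JaffeJanssens2016, Weingarten1983, kit:j000711
[crux] SPECIES LEVEL. For every m > 0 there is a θ-symmetric open box (as in NoDiagonalFermionRP) on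
which the reflected flavour-changing pseudoscalar two-point kernel across the diagonal mirror at the
free point, G(x,y) = tr[γ₅ C(θx,y) γ₅ C(y,θx)] on Λ₊ (the Θ-image of ψ̄_f iγ₅ ψ_g by the
order-reversing bilinear rule of MontvayMunster1994 (4.92) with γ₄ ↦ γ_n; −⟨Θ(F)F⟩ up to a positive
colour factor), is INDEFINITE: some v gives a negative, some w a positive value of the Hermitian
form. This is the sector of the species `QCDField.pseudoRe f g`; indefiniteness there blocks
inheritance of diagonal RP for the quark-bilinear species at the weak-coupling end (β → ∞ on a fixed
box, by continuity of finite-box expectations of gauge-invariant F). [deps: NoDiagonalFermionRP]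
[difficulty: M] -/
@[route_item "route-QuantumFields-FourMirrorsWardE1"]
def PseudoscalarDiagonalRPFails : Prop :=
  ∀ (m : ℝ), 0 < m → ∃ R : ℕ, let n : ℕ := 2 * R + 3; let ι : (Fin 4 → Fin n) → Literature.Probability.LatticeModels.TorusSite 4 (n + 1) := fun x i => ((x i : ℕ) : ZMod (n + 1)); let D : Matrix ((Fin 4 → Fin n) × Fin 4) ((Fin 4 → Fin n) × Fin 4) ℂ := (Literature.MathematicalPhysics.QuantumLattice.wilsonDirac (L := n + 1) (1 : Unit →* Matrix (Fin 1) (Fin 1) ℂ) (fun _ => ()) m 1).submatrix (fun p => (ι p.1, (0 : Fin 1), p.2)) (fun p => (ι p.1, (0 : Fin 1), p.2)); let θ : (Fin 4 → Fin n) → (Fin 4 → Fin n) := fun x => x ∘ Equiv.swap (0 : Fin 4) 1; let Cb : (Fin 4 → Fin n) → (Fin 4 → Fin n) → Matrix (Fin 4) (Fin 4) ℂ := fun x y => Matrix.of fun α β => D⁻¹ (x, α) (y, β); let G : Matrix {x : Fin 4 → Fin n // x 1 < x 0} {x : Fin 4 → Fin n // x 1 < x 0} ℂ := Matrix.of fun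 x y => (Literature.MathematicalPhysics.QuantumLattice.gammaFive * Cb (θ x.1) y.1 * Literature.MathematicalPhysics.QuantumLattice.gammaFive * Cb y.1 (θ x.1)).trace; ∃ v w : {x : Fin 4 → Fin n // x 1 < x 0} → ℂ, (star v ⬝ᵥ G.mulVec v).re < 0 ∧ 0 < (star w ⬝ᵥ G.mulVec w).re

/-- item stmt-QuantumFields-18092 · crux · rank 6 · open · by planner
why it might fail: Constructive core: no UV-stable construction of 4D SU(3) with dynamical Wilson quarks (Balaban: pure YM; BOS fermions small-field only), no engine for the volume-uniform lattice gap through the crossover, Z_m log-law beyond PT, IsChiralAtZero imports Goldstone gaplessness (Sharpe–Singleton risk).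
sources: JaffeWitten2000, OsterwalderSeiler1978, Seiler1982, MontvayMunster1994, Balaban1989LargeFieldII, BalabanOcarrollSchor1989
[crux] THE EXISTENCE HALF of QCDHypercubicLimit (crux-strategist BC2 redirect 2026-08-17, piece 1 of
2; LINE-NEUTRAL — the lattice-package seam every existence route of the sub uses, cf. the registered
birth skeletons of FourMirrorsWardE1.QCDModuloRotations (stmt-QuantumFields-17271) and
GapBuysCauchyRate.ConvergentOSClosure (stmt-QuantumFields-11525)). For N_f = 2 and N_f = 3: one
mass-independent regularisation reg with leading-log mass scaling (`reg.HasMassScaling`) and chiral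
at zero (`reg.IsChiralAtZero`) such that for every tuple of positive renormalised masses there are
species renormalisations z, shift and a labelled Schwinger family S over QCDField N_f which is
normalised (E0), of linear growth (E0'), symmetric (E3), translation invariant and invariant under
the proper signed permutations (W(B₄) ∩ SO(4)) on ⁰𝒮, IS the k → ∞ limit of the honest lattice-QCD
n-point functions `qcdLatticeSchwinger (reg.scheme m z shift) k` on off-diagonal real tensors
(two-loop asymptotic scaling, bare Wilson masses eventually on the physical branch m_f(k) > −1),
carries a uniform lattice mass gap Δ > 0 (`HasLatticeMassGap`) at the same couplings, and has
non-trivial and non-Gaussian glue and -/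
@[route_item "route-QuantumFields-FourMirrorsWardE1", crux]
def HonestLatticeLimit : Prop :=
  open Literature.MathematicalPhysics.QuantumLattice Literature.MathematicalPhysics.AQFT Literature.MathematicalPhysics.QuantumFieldTheory in let E := EuclideanSpace ℝ (Fin 4); let P := fun (Nf : ℕ) (sch : QCDScheme Nf) (S : LabelledSchwingerFamily (QCDField Nf) E) => ((S.IsNormalized ∧ S.HasLinearGrowth ∧ S.IsSymmetric ∧ (∀ (n : ℕ) (k : Fin n → QCDField Nf) (a : E) (F : SchwartzMap (Fin n → E) ℂ), IsOffDiagonal F → S n k (translateMulti a F) = S n k F) ∧ (∀ (n : ℕ) (k : Fin n → QCDField Nf) (R : E ≃ₗᵢ[ℝ] E), LinearMap.det (R.toLinearEquiv : E →ₗ[ℝ] E) = 1 → (∀ i : Fin 4, ∃ j : Fin 4, R (EuclideanSpace.single i 1) = EuclideanSpace.single j 1 ∨ R (EuclideanSpace.single i 1) = -EuclideanSpace.single j 1) → ∀ F : SchwartzMap (Fin n → E) ℂ, IsOffDiagonal F → S n k (linActMulti R F) = S n k F)) ∧ (sch.HasAsymptoticScaling ∧ (∀ fl : Fin Nf, ∀ᶠ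 k in Filter.atTop, -1 < sch.mq fl k) ∧ (∀ (n : ℕ), n ≠ 0 → ∀ (σ : Fin n → QCDField Nf) (f : Fin n → SchwartzMap E ℝ) (F : SchwartzMap (Fin n → E) ℂ), IsTensorOf F (fun i => ofRealTest (f i)) → IsOffDiagonal F → Filter.Tendsto (fun k : ℕ => qcdLatticeSchwinger sch k n σ f) Filter.atTop (nhds (S n σ F)))) ∧ (∃ Δ : ℝ, 0 < Δ ∧ sch.HasLatticeMassGap Δ)); let NT := fun (Nf : ℕ) (S : LabelledSchwingerFamily (QCDField Nf) E) (s : QCDField Nf) => (∃ (F G : SchwartzMap (Fin 1 → E) ℂ) (H : SchwartzMap (Fin (1 + 1) → E) ℂ), IsTimeOrdered F ∧ IsTimeOrdered G ∧ IsAppendTensorOf H (osAdjoint F) G ∧ S (1 + 1) (fun _ => s) H ≠ S 1 (fun _ => s) (osAdjoint F) * S 1 (fun _ => s) G); let NG := fun (Nf : ℕ) (S : LabelledSchwingerFamily (QCDField Nf) E) (s : QCDField Nf) => (∃ (f g h : SchwartzMap E ℂ) (Ffgh : SchwartzMap (Fin 3 → E) ℂ) (Fgh Ffh Ffg : SchwartzMap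 (Fin 2 → E) ℂ) (Ff Fg Fh : SchwartzMap (Fin 1 → E) ℂ), IsTensorOf Ffgh ![f, g, h] ∧ IsOffDiagonal Ffgh ∧ IsTensorOf Fgh ![g, h] ∧ IsTensorOf Ffh ![f, h] ∧ IsTensorOf Ffg ![f, g] ∧ IsTensorOf Ff ![f] ∧ IsTensorOf Fg ![g] ∧ IsTensorOf Fh ![h] ∧ S 3 (fun _ => s) Ffgh - S 1 (fun _ => s) Ff * S 2 (fun _ => s) Fgh - S 1 (fun _ => s) Fg * S 2 (fun _ => s) Ffh - S 1 (fun _ => s) Fh * S 2 (fun _ => s) Ffg + 2 * (S 1 (fun _ => s) Ff * S 1 (fun _ => s) Fg * S 1 (fun _ => s) Fh) ≠ 0); ∀ Nf : ℕ, (Nf = 2 ∨ Nf = 3) → ∃ reg : QCDRegularisation Nf, reg.HasMassScaling ∧ reg.IsChiralAtZero ∧ ∀ m : Fin Nf → ℝ, (∀ f, 0 < m f) → ∃ (z shift : QCDField Nf → ℕ → ℝ) (S : LabelledSchwingerFamily (QCDField Nf) E), P Nf (reg.scheme m z shift) S ∧ NT Nf S QCDField.glue ∧ NG Nf S QCDField.glue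 ∧ (∀ f g : Fin Nf, f ≠ g → NT Nf S (QCDField.pseudoRe f g))

/-- item stmt-QuantumFields-18093 · crux · rank 7 · open · by planner
why it might fail: HasLatticeMassGap bounds FIXED observable pairs (free constants), not the k-dependent renormalised smeared fields — same-rate transfer needs the transfer-matrix spectral reading; RP of the limit needs S→∞ before k→∞ for the time-PERIODIC torus functional ((−1)^F trace).
sources: OsterwalderSchrader1973, OsterwalderSchrader1975, GlimmJaffe1987, OsterwalderSeiler1978, Luscher1977, Seiler1982
[support — filed as support ONLY because of the 7-crux cap; an OPEN piece (XL) with its own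
why-might-fail: HasLatticeMassGap bounds FIXED observable pairs with free constants, not the
k-dependent renormalised smeared fields (same-rate transfer needs the transfer-matrix spectral
reading); RP of the limit needs S→∞ before k→∞ for the time-PERIODIC torus functional] THE CLOSURE
HALF of QCDHypercubicLimit (piece 2 of 2; universal — model-specific only through the honest lattice
functional). For every N_f, every sequential lattice-QCD scheme sch with two-loop asymptotic scaling
and bare Wilson masses eventually on the physical branch m_f(k) > −1, and every labelled Schwinger
family S over QCDField N_f that is normalised, of linear growth, translation invariant on ⁰𝒮 and IS
the k → ∞ limit of the honest `qcdLatticeSchwinger sch k` on off-diagonal real tensors: every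
uniform lattice mass gap Δ > 0 of sch (`HasLatticeMassGap Δ`: all pairs of gauge-invariant local
lattice observables, free constants, all tori ≥ the scheme's) makes S hermitian (E0), reflection
positive (E2) and clustering (E4) AND gives the species mass gap `S.HasMassGap Δ` at the SAME rate.
Intended proof = the three closu -/
@[route_item "route-QuantumFields-FourMirrorsWardE1", crux]
def GappedLimitClosure : Prop :=
  open Literature.MathematicalPhysics.QuantumLattice Literature.MathematicalPhysics.AQFT Literature.MathematicalPhysics.QuantumFieldTheory in let E := EuclideanSpace ℝ (Fin 4); ∀ (Nf : ℕ) (sch : QCDScheme Nf) (S : LabelledSchwingerFamily (QCDField Nf) E), sch.HasAsymptoticScaling → (∀ fl : Fin Nf, ∀ᶠ k in Filter.atTop, -1 < sch.mq fl k) → S.IsNormalized → S.HasLinearGrowth → (∀ (n : ℕ) (k : Fin n → QCDField Nf) (a : E) (F : SchwartzMap (Fin n → E) ℂ), IsOffDiagonal F → S n k (translateMulti a F) = S n k F) → (∀ (n : ℕ), n ≠ 0 → ∀ (σ : Fin n → QCDField Nf) (f : Fin n → SchwartzMap E ℝ) (F : SchwartzMap (Fin n → E) ℂ), IsTensorOf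 F (fun i => ofRealTest (f i)) → IsOffDiagonal F → Filter.Tendsto (fun k : ℕ => qcdLatticeSchwinger sch k n σ f) Filter.atTop (nhds (S n σ F))) → ∀ Δ : ℝ, 0 < Δ → sch.HasLatticeMassGap Δ → (S.IsHermitian ∧ S.IsReflectionPositive ∧ S.HasClusterProperty ∧ S.HasMassGap Δ)

-- earlier QCDModuloRotations (stmt-QuantumFields-8842, replaced 2026-08-16T23:11:31Z -> stmt-QuantumFields-17271): retired by None — ∀ Nf : ℕ, (Nf = 2 ∨ Nf = 3) → ∃ reg : Literature.MathematicalPhysics.QuantumFieldTheory.QCDRegularisation Nf, reg.HasMassScaling ∧ ∀ m : Fin Nf → ℝ, (∀ f, 0 < m f) → ∃ (z shift : Literature.MathematicalPhysics.QuantumFieldTheory.QCDField Nf → ℕ → ℝ) (S : Literature.Mat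
/-- item stmt-QuantumFields-17271 · support · rank 5 · open · by planner
why it might fail: = QCDOf 2∧3 minus rotation-E1: no UV-stable construction of 4D SU(3) with dynamical Wilson quarks (Bałaban: pure YM, small fields); no engine for the volume-uniform lattice gap; Z_m log-law beyond PT; IsChiralAtZero imports Goldstone gaplessness as m→0⁺ (fixed-a Wilson pions may stay massive).
sources: JaffeWitten2000, OsterwalderSeiler1978, GlimmJaffe1987, Literature.Barriers.QuantumFields.UVStabilityNonUniqueness
[crux] THE REST OF THE CONJUNCT. For N_f = 2 and N_f = 3: one mass-independent regularisation reg
with leading-log mass scaling (`reg.HasMassScaling`) which is CHIRAL AT ZERO (`reg.IsChiralAtZero`,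
statement re-type p117723: for every ε > 0 some tuple of positive renormalised masses has NO uniform
lattice gap ε — the lattice gap closes as m → 0⁺, pinning the additive offset of m_crit to the
chiral point; physics imported: Goldstone gaplessness of massless N_f ≥ 2 QCD) such that for every
tuple of positive renormalised masses there are species renormalisations z, shift and a labelled
Schwinger family S with E0 (normalisation, hermiticity), E0', TRANSLATION invariance, E2, E3, E4,
which is the sequential continuum limit of honest lattice QCD along reg.scheme m z shift (asymptotic
scaling, physical branch, convergence on off-diagonal tensors), has a mass gap Δ > 0 of all species
strings together with the uniform lattice gap at the same couplings (Δ depends on m, consistent with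
the chiral clause), and which — once the rotation half of E1 holds for S — packages into OS data T
(T.schwinger = S) with non-trivial, non-Gaussian glue and every flavour-changing pseudoscalar
non-trivial. Exac -/
@[route_item "route-QuantumFields-FourMirrorsWardE1"]
def QCDModuloRotations : Prop :=
  ∀ Nf : ℕ, (Nf = 2 ∨ Nf = 3) → ∃ reg : Literature.MathematicalPhysics.QuantumFieldTheory.QCDRegularisation Nf, reg.HasMassScaling ∧ reg.IsChiralAtZero ∧ ∀ m : Fin Nf → ℝ, (∀ f, 0 < m f) → ∃ (z shift : Literature.MathematicalPhysics.QuantumFieldTheory.QCDField Nf → ℕ → ℝ) (S : Literature.MathematicalPhysics.AQFT.LabelledSchwingerFamily (Literature.MathematicalPhysics.QuantumFieldTheory.QCDField Nf) (EuclideanSpace ℝ (Fin 4))), S.IsNormalized ∧ S.IsHermitian ∧ S.HasLinearGrowth ∧ (∀ (n : ℕ) (σ : Fin n → Literature.MathematicalPhysics.QuantumFieldTheory.QCDField Nf) (a : EuclideanSpace ℝ (Fin 4)) (F : SchwartzMap (Fin n → EuclideanSpace ℝ (Fin 4)) ℂ), Literature.MathematicalPhysics.AQFT.IsOffDiagonal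 F → S n σ (Literature.MathematicalPhysics.QuantumLattice.translateMulti a F) = S n σ F) ∧ S.IsReflectionPositive ∧ S.IsSymmetric ∧ S.HasClusterProperty ∧ (reg.scheme m z shift).HasAsymptoticScaling ∧ (∀ fl : Fin Nf, ∀ᶠ k in Filter.atTop, -1 < (reg.scheme m z shift).mq fl k) ∧ (∀ n : ℕ, n ≠ 0 → ∀ (σ : Fin n → Literature.MathematicalPhysics.QuantumFieldTheory.QCDField Nf) (f : Fin n → SchwartzMap (EuclideanSpace ℝ (Fin 4)) ℝ) (F : SchwartzMap (Fin n → EuclideanSpace ℝ (Fin 4)) ℂ), Literature.MathematicalPhysics.QuantumLattice.IsTensorOf F (fun i => Literature.MathematicalPhysics.QuantumLattice.ofRealTest (f i)) → Literature.MathematicalPhysics.AQFT.IsOffDiagonal F → Filter.Tendsto (fun k : ℕ => Literature.MathematicalPhysics.QuantumFieldTheory.qcdLatticeSchwinger (reg.scheme m z shift) k n σ f) Filter.atTop (nhds (S n σ F))) ∧ (∃ Δ : ℝ, 0 < Δ ∧ S.HasMassGap Δ ∧ (reg.scheme m z shift).HasLatticeMassGap Δ) ∧ ((∀ (n : ℕ)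 (σ : Fin n → Literature.MathematicalPhysics.QuantumFieldTheory.QCDField Nf) (Rot : EuclideanSpace ℝ (Fin 4) ≃ₗᵢ[ℝ] EuclideanSpace ℝ (Fin 4)), LinearMap.det (Rot.toLinearEquiv : EuclideanSpace ℝ (Fin 4) →ₗ[ℝ] EuclideanSpace ℝ (Fin 4)) = 1 → ∀ F : SchwartzMap (Fin n → EuclideanSpace ℝ (Fin 4)) ℂ, Literature.MathematicalPhysics.AQFT.IsOffDiagonal F → S n σ (Literature.MathematicalPhysics.QuantumLattice.linActMulti Rot F) = S n σ F) → ∃ T : Literature.MathematicalPhysics.QuantumFieldTheory.OSData (Literature.MathematicalPhysics.QuantumFieldTheory.QCDField Nf) 4, T.schwinger = S ∧ T.IsNontrivial Literature.MathematicalPhysics.QuantumFieldTheory.QCDField.glue ∧ T.IsNonGaussian Literature.MathematicalPhysics.QuantumFieldTheory.QCDField.glue ∧ ∀ f g : Fin Nf, f ≠ g → T.IsNontrivial (Literature.MathematicalPhysics.QuantumFieldTheory.QCDField.pseudoRe f g))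

/-- item stmt-QuantumFields-8843 · support · rank 9 · closed · proved by Summit.QuantumFields.QCD.Theorems.fourMirrorsWardE1_matrixTwoExpKernel_proof (prover) · by planner
sources: Literature.Barriers.QuantumFields.RegularisationDichotomy, GlimmJaffe1987
[support] ENGINE OF THE TWO-POLE MECHANISM (matrix Källén–Lehmann atoms). For Hermitian A, B ∈
M_d(ℂ) and 0 < ζ₁ ≠ ζ₂ the block Hankel kernel (k,k') ↦ ζ₁^{k+k'}A + ζ₂^{k+k'}B on k, k' ≥ 1 is of
positive type iff A ≥ 0 and B ≥ 0 (Gram identity; witness k = (1,2), c = (ζ₂v, −v) kills the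
B-square). Scalar case proved in tree: Literature.Barriers.QuantumFields.not_isRPKernel_twoExpKernel
/ isRPKernel_twoExpKernel_of_nonneg. [difficulty: provable-now] -/
@[route_item "route-QuantumFields-FourMirrorsWardE1"]
def MatrixTwoExpKernel : Prop :=
  ∀ (d : ℕ) (A B : Matrix (Fin d) (Fin d) ℂ) (ζ₁ ζ₂ : ℝ), A.IsHermitian → B.IsHermitian → 0 < ζ₁ → 0 < ζ₂ → ζ₁ ≠ ζ₂ → ((∀ (N : ℕ) (k : Fin N → ℕ) (c : Fin N → Fin d → ℂ), (∀ i, 0 < k i) → 0 ≤ (∑ i, ∑ j, star (c i) ⬝ᵥ (((ζ₁ : ℂ) ^ (k i + k j) • A + (ζ₂ : ℂ) ^ (k i + k j) • B).mulVec (c j))).re) ↔ ((∀ v : Fin d → ℂ, 0 ≤ (star v ⬝ᵥ A.mulVec v).re) ∧ (∀ v : Fin d → ℂ, 0 ≤ (star v ⬝ᵥ B.mulVec v).re)))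

-- `MatrixTwoExpKernel` holds: proved by `Summit.QuantumFields.QCD.Theorems.fourMirrorsWardE1_matrixTwoExpKernel_proof` (its module imports this route file, so no `_holds` link can be stated here).

/-- item stmt-QuantumFields-8844 · support · rank 9 · open · by planner
sources: kit:j000711, MontvayMunster1994
[support] THE CHEAPEST CERTIFIED INSTANCE of NoDiagonalFermionRP: m = 1, box 3⁴ (R = 0), all S ≠ 0.
Everything is exact linear algebra over ℚ(i) (D is 324 × 324; the Hermiticity constraints on the 32
real parameters of S have a one-dimensional solution space ℝγ_n — j000711: smallest singular values
3·10⁻⁹, 0.034, 0.042 —, and K_{γ_n} has eigenvalues of both signs, [−0.049, +0.0037]); a prover may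
certify ~10 entries of D⁻¹ by sparse solves D h = e and two rational test vectors. [difficulty:
provable-now] -/
@[route_item "route-QuantumFields-FourMirrorsWardE1"]
def NoDiagonalFermionRPUnitMass : Prop :=
  ∀ (S : Matrix (Fin 4) (Fin 4) ℂ), S ≠ 0 → let ι : (Fin 4 → Fin 3) → Literature.Probability.LatticeModels.TorusSite 4 4 := fun x i => ((x i : ℕ) : ZMod 4); let D : Matrix ((Fin 4 → Fin 3) × Fin 4) ((Fin 4 → Fin 3) × Fin 4) ℂ := (Literature.MathematicalPhysics.QuantumLattice.wilsonDirac (L := 4) (1 : Unit →* Matrix (Fin 1) (Fin 1) ℂ) (fun _ => ()) 1 1).submatrix (fun p => (ι p.1, (0 : Fin 1), p.2)) (fun p => (ι p.1, (0 : Fin 1), p.2)); let θ : (Fin 4 → Fin 3) → (Fin 4 → Fin 3) := fun x => x ∘ Equiv.swap (0 : Fin 4) 1; let K : Matrix ({x : Fin 4 → Fin 3 // x 1 < x 0} × Fin 4) ({x : Fin 4 → Fin 3 // x 1 < x 0} × Fin 4) ℂ := Matrix.of fun p q => -∑ β : Fin 4, D⁻¹ (q.1.1, q.2) (θ p.1.1,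 β) * S β p.2; ¬ (K.IsHermitian ∧ ∀ v : {x : Fin 4 → Fin 3 // x 1 < x 0} × Fin 4 → ℂ, 0 ≤ (star v ⬝ᵥ K.mulVec v).re)

-- earlier Assembly (stmt-QuantumFields-8845, replaced 2026-08-17T15:07:15Z -> stmt-QuantumFields-18367): retired by None — RotationRestoration → QCDModuloRotations → QCD
/-- item stmt-QuantumFields-18367 · assembly · rank 1 · closed · proved by Summit.QuantumFields.QCD.Theorems.fourMirrorsWardE1_assembly_proof (prover) · by planner
sources: JaffeWitten2000, OsterwalderSchrader1975
[assembly] RotationRestoration → HonestLatticeLimit → GappedLimitClosure → QCD — the current frame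
of the route (rev 9: the existence half stmt-18092 and the closure half stmt-18093 of the derived
node QCDModuloRotations, plus the E1 module) implies the sub-problem statement QCD := QCDOf 2 ∧
QCDOf 3; verbatim the type of the deciding theorem closes (provable now: fun h₁ h₂ h₃ => closes h₁
h₂ h₃). The earlier frame RotationRestoration → QCDModuloRotations → QCD remains true (strategist
evidence Costume.lean, assembly_holds). -/
@[route_item "route-QuantumFields-FourMirrorsWardE1"]
def Assembly : Prop :=
  RotationRestoration → HonestLatticeLimit → GappedLimitClosure → QCD

-- `Assembly` holds: proved by `Summit.QuantumFields.QCD.Theorems.fourMirrorsWardE1_assembly_proof` (its module imports this route file, so no `_holds` link can be stated here).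

/-! D-0027 §2.1 — DECIDING THEOREM (planner-authored via `route open/edit --closes-file`; by planner-cstrat-stmt-QuantumFields-17271-r1-0 2026-08-17T15:04:23Z):
its hypotheses are this route's items and its conclusion the sub-problem Statement (glue_lint), and it elaborates with this file. -/

@[closes "route-QuantumFields-FourMirrorsWardE1"] theorem closes (hRot : RotationRestoration) (hLim : HonestLatticeLimit) (hClos : GappedLimitClosure) : QCD := by
  -- derived node (crux-strategist r1 BC2 redirect of QCDModuloRotations, stmt-17271; standalone kernel-checked glue
  -- `QCDModuloRotations_of_subs`, Theorems/FourMirrorsWardE1QCDModuloRotationsSplit.lean): the existence half and the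
  -- closure half give the route's former deciding crux `QCDModuloRotations` BY NAME
  have hMod : QCDModuloRotations := by
    intro Nf hNf
    obtain ⟨reg, hms, hchi, hall⟩ := hLim Nf hNf
    refine ⟨reg, hms, hchi, fun m hm => ?_⟩
    obtain ⟨z, shift, S, ⟨⟨hnorm, hgrowth, hsymm, htr, -⟩, ⟨hAF, hbr, hconv⟩, Δ, hΔ, hlat⟩, hnt, hng, hdyn⟩ :=
      hall m hm
    obtain ⟨hherm, hrp, hclus, hgap⟩ :=
      hClos Nf (reg.scheme m z shift) S hAF hbr hnorm hgrowth htr hconv Δ hΔ hlat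
    refine ⟨z, shift, S, hnorm, hherm, hgrowth, htr, hrp, hsymm, hclus, hAF, hbr, hconv, ⟨Δ, hΔ, hgap, hlat⟩,
      fun hR => ?_⟩
    have hOS : Literature.MathematicalPhysics.AQFT.OSAxiomsSchwinger S :=
      { normalized := hnorm
        hermitian := hherm
        invariant := ⟨htr, hR⟩
        reflectionPositive := hrp
        symmetric := hsymm
        cluster := hclus
        linearGrowth := hgrowth }
    exact ⟨Literature.MathematicalPhysics.QuantumFieldTheory.OSData.ofAxioms S hOS, rfl, hnt, hng, hdyn⟩
  -- the rest is the route's deciding logic, unchanged since rev 5: RotationRestoration supplies the rotation half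
  -- of E1 for the limit family, the packaging clause gives `T` with `T.schwinger = S`, and `QCDOf 2 ∧ QCDOf 3` follows
  have hOf : ∀ Nf : ℕ, (Nf = 2 ∨ Nf = 3) → QCDOf Nf := by
    intro Nf hNf
    obtain ⟨reg, hScal, hChi, hAll⟩ := hMod Nf hNf
    refine ⟨reg, hScal, hChi, fun m hm => ?_⟩
    obtain ⟨z, shift, S, -, -, -, -, -, -, -, hAS, hBranch, hConv, ⟨Δ, hΔ, hGapS, hGapL⟩, hPack⟩ :=
      hAll m hm
    have hE1 := hRot Nf (reg.scheme m z shift) hAS hBranch ⟨Δ, hΔ, hGapL⟩ S hConv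
    obtain ⟨T, hTS, hNT, hNG, hND⟩ := hPack hE1
    subst hTS
    exact ⟨z, shift, T, ⟨hAS, hBranch, hConv⟩, hNT, hNG, hND, Δ, hΔ, hGapS, hGapL⟩
  exact ⟨hOf 2 (Or.inl rfl), hOf 3 (Or.inr rfl)⟩

end Summit.QuantumFields.QCD.Theses.FourMirrorsWardE1
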